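import Literature.Computability.QuantumComplexity.HTCnotUniversality
import HarnessLib

/-!
# Universality of Clifford+T (`cliffordT.IsUniversal`) from the universality of `{H, T, CNOT}`

Topic `Literature/Computability/QuantumComplexity`. Towards the discharge of the named fact
`Literature.Computability.QuantumComplexity.cliffordT_isUniversal` of `BQP.lean`
(`cliffordT.IsUniversal`: for all large `n` the placements of the Clifford+T gates `{H, S, T, CNOT}`
on `n` wires generate a dense subgroup of `U(2^n)` modulo global phase; Boykin–Mor–Pulver–
Roychowdhury–Vatan, FOCS 1999, §3; Nielsen–Chuang §4.5.3). This file proves the reductions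

* `cliffordT_generatesDenselyModPhase_of_hTCnot` — the literal `{H, T, CNOT}` form
  `hTCnot_generatesDenselyModPhase` (S08) implies the Clifford+T form
  `cliffordT_generatesDenselyModPhase` (the `{H, T, CNOT}`-placements are Clifford+T placements,
  `hTCnotPlacements_subset_placements`);
* `cliffordT_isUniversal_of_generatesDenselyModPhase` — which gives `cliffordT_isUniversal` with
  threshold `n₀ = 1` (this was the interim proof recorded in `BQP.lean`);
* **`cliffordT_isUniversal_of`** — hence `cliffordT_isUniversal` follows from the two printed
  ingredients of Boykin et al. §3 as vendored in `HTCnotUniversality.lean`: exact universality of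
  one-qubit gates with `CNOT` (`barenco1995_exactUniversality`, Barenco et al. 1995) and density
  of `⟨H, T⟩` in `U(2)` modulo phase (`boykin1999_HT_generatesDenselyModPhase`), through the
  proved assembly `hTCnot_generatesDenselyModPhase_of`.

No definition or named fact is introduced; with the discharges of the two ingredients,
`cliffordT_isUniversal_holds` is `cliffordT_isUniversal_of ‹_› ‹_›`.

## References

* P. O. Boykin, T. Mor, M. Pulver, V. Roychowdhury, F. Vatan, *On universal and fault-tolerant
  quantum computing*, FOCS 1999, 486–494, arXiv:quant-ph/9906054, §3 [BoykinEtAl1999].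
* A. Barenco et al., *Elementary gates for quantum computation*, Phys. Rev. A 52 (1995)
  3457–3467, abstract and §8 [BarencoEtAl1995].
* M. A. Nielsen, I. L. Chuang, *Quantum Computation and Quantum Information*, CUP 2010, §4.5.3
  [NielsenChuang2010].
-/

noncomputable section

namespace Literature.Computability.QuantumComplexity

open _root_.Matrix Cryptography

/-- The `{H, T, CNOT}` form of S08 implies the Clifford+T form: for every `n ≥ 1` the Clifford+T
placements generate `U(2^n)` densely modulo phase — the generated subgroup only grows when the
generating set does, and `hTCnotPlacements n ⊆ placements cliffordT n`
(monotonicity as in `GeneratesDenselyModPhase.mono` of `JonesInBQPProofs`, inlined to keep the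
imports light). [cite: BoykinEtAl1999, §3] -/
theorem cliffordT_generatesDenselyModPhase_of_hTCnot (h : hTCnot_generatesDenselyModPhase) :
    cliffordT_generatesDenselyModPhase := by
  intro n hn
  have h' := h n hn
  unfold GeneratesDenselyModPhase at h' ⊢
  refine h'.mono (Subgroup.closure_mono fun U hU => hU.imp (fun hS => ?_) id)
  exact hTCnotPlacements_subset_placements n hS

/-- Clifford+T is universal at the placement level with threshold `n₀ = 1`, given S08 (this is
the interim proof `⟨1, cliffordT_generatesDenselyModPhase⟩` recorded in `BQP.lean`).
[cite: BoykinEtAl1999, §3] -/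
theorem cliffordT_isUniversal_of_generatesDenselyModPhase
    (h : cliffordT_generatesDenselyModPhase) : cliffordT_isUniversal :=
  ⟨1, h⟩

/-- **`cliffordT_isUniversal` from the two printed ingredients of Boykin et al. 1999, §3**:
exact universality of one-qubit gates with `CNOT` (Barenco et al. 1995, abstract and §8) and
density of `⟨H, σ_z^{1/4}⟩` in `U(2)` modulo phase (Boykin et al. §3, first step), via the proved
assembly `hTCnot_generatesDenselyModPhase_of` and the two reductions above.
[cite: BoykinEtAl1999, §3] -/
theorem cliffordT_isUniversal_of (hB : barenco1995_exactUniversality)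
    (hD : boykin1999_HT_generatesDenselyModPhase) : cliffordT_isUniversal :=
  cliffordT_isUniversal_of_generatesDenselyModPhase
    (cliffordT_generatesDenselyModPhase_of_hTCnot (hTCnot_generatesDenselyModPhase_of hB hD))

end Literature.Computability.QuantumComplexity
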